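import Summits.AnomalousDissipation.AnomalousDissipation.Theorems.SawtoothPulseCascadeK1LocalisedCascadeCanonicalRatioStepsCTE
import Summits.AnomalousDissipation.AnomalousDissipation.Theorems.SawtoothPulseCascadeK1LocalisedCascadeBlockJunkCTEGeom
import Summits.AnomalousDissipation.AnomalousDissipation.Theorems.SawtoothPulseCascadeK1LocalisedCascadeGeomBlocks

/-!
# K1loc — helper: THE RATIO-CLASS STEPS ON GEOMETRIC BLOCKS OF ARBITRARY RATIO, CORNER-TRACE GRADE, AGGREGATE TRACKED ENERGY

Helper file of the prover lane on the crux `K1LocalisedCascade` (stmt-AnomalousDissipation-19491), route `SawtoothPulseCascade`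
(S-D seat, arbiter A24-4: the phase-3 CT ledger; finding F-p1g8-1 §2).  `…CanonicalRatioStepsCTE` on the DYADIC blocks
loses a factor `≈ 3–5` in the residue junk at phase 3 (`β* ∝ ρ³` in the block ratio `ρ`); this file is the same step —
`…RatioBlocksCTE.tsum_ratioClass_{v,h}step_blocks_ctE_le` with every per-block scalar discharged — on the family
`Λ_m = ⌊Λ₀(r_a)^m/(r_b)^m⌋` of `…GeomBlocks` (`ρ = r_a/r_b > 1`; e.g. `9/8`, `6/5`) with the thin cut-offs `Q₂^m = ⌊q_nΛ_m/q_d⌋`,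
`Q₁^m = ⌊u′Λ_{m+1}/v′⌋` and the closed forms of `…BlockJunkCTEGeom`:
  `class ≤ (√(A + β*/2) + √(ρ*/2 + Z) + √feed)² + tail²`,
  `A = 6N²r*(ρ²/((ρ²−1)S₀²) + ρ/((ρ−1)NS₀))/π²`, `β* = 12N²ϑ²(2q₀/(NS₀²) + 2q₀/(N²S₀) + 1/S₀² + 1/(NS₀))/π²`,
  `ρ* = (πΛ₀Gρ^{M_b}ε/N)²`, `Z = M_b·(8Mδ_j·r*/π)`, `r* = (c_d + c_n)/(c_d − c_n)`,
`S₀ = (uG−v)(Λ₀−1)/u`, `q₀ = q_nΛ₀/q_d`, `ϑ = uq_nΛ₀/(((uG−v)q_d − uq_n)(Λ₀−1))` (`N = N_j`).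
* `ratioClass_vstep_geomCTE_le` (V: O-V, A-V), `ratioClass_hstep_geomCTE_le` (H: C-H, B-H).
No definitions; no statement about the crux. [cite: Grafakos2014, Prop. 3.1.2 (5), Prop. 3.2.7 (3), §3.1.3] [problem: turb]
-/

-- `Summit.<Summit>.<Problem>`: single-conjunct summit, the duplicate namespace segment is deliberate.
set_option linter.dupNamespace false

noncomputable section

namespace Summit.AnomalousDissipation.AnomalousDissipation.Theorems.SawtoothPulseCascade.K1Window

open MeasureTheory Set Filter Topology UnitAddTorus Function Complex Metric
open scoped Real ENNReal
open Literature.Analysis Literature.Analysis.FunctionSpaces Literature.Analysis.FunctionSpaces.Torus Literature.Analysis.FluidPDE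
open Literature.Analysis.FluidPDE.ShearStage
open Literature.Analysis.FluidPDE.SawtoothCascade Literature.Analysis.FluidPDE.SawtoothCascade.CascadeParams
open Summit.AnomalousDissipation.AnomalousDissipation.Theorems.SawtoothPulseCascade.K1Start
open Summit.AnomalousDissipation.AnomalousDissipation.Theorems.SawtoothPulseCascade.K1Flat
open Summit.AnomalousDissipation.AnomalousDissipation.Theorems.SawtoothPulseCascade.K1Ledger.From

section Cascade

variable (P : CascadeParams)

/-! ## §1 The steps -/

/-- **(O-V) / (A-V) ON GEOMETRIC BLOCKS OF RATIO `a/b`, CT GRADE, AGGREGATE TRACKED ENERGY.**  Class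
`Σ'[X ≤ |k₀| ∧ u|k₀| ≤ v|k₁|]‖𝓕a_{j+1}‖²` (`0 < u`, `0 < v < uG`), fibre floor `Λ₀ ≥ 2` with `vΛ₀ ≤ uX`, blocks `Λ_m = ⌊Λ₀(r_a)^m/(r_b)^m⌋`
(`0 < r_b < r_a`), lobe `Q₂^m = ⌊q_nΛ_m/q_d⌋` (`uq_n < q_d(uG − v)`), plateau = feed cut-off `Q₁^m = ⌊u′Λ_{m+1}/v′⌋` (feed slope
`(u′, v′)`, threshold `Y ≤ ⌊u′Λ₀/v′⌋ + 1`), separation and cut-off fraction `c_n/c_d` from slope + base at `Λ₀` (`…GeomBlocks`),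
`M_b` blocks, zone parameter `M ≥ 1` with `Mδ_j < π/2`, rounding `ε ≥ e^{−M²/2}`.  Then
`class ≤ (√(A + β*/2) + √(ρ*/2 + Z) + √(Σ'[Y ≤ |k₀| ∧ u′|k₁| ≤ v′|k₀|]‖𝓕b_j‖²))² + ((1+γ)^{2(j+1)}/Λ_{M_b})²` with the closed
forms of the file header (`S₀ = (uG−v)(Λ₀−1)/u`, `q₀ = q_nΛ₀/q_d`, `ϑ = uq_nΛ₀/(((uG−v)q_d − uq_n)(Λ₀−1))`, `r* = (c_d+c_n)/(c_d−c_n)`).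
[cite: Grafakos2014, Prop. 3.1.2 (5), Prop. 3.2.7 (3), §3.1.3] -/
theorem ratioClass_vstep_geomCTE_le {G : ℕ} (hγ : P.γ = G) (hδ₀ : 0 < P.δ₀) (hd : 0 < P.d) (hN₀ : 1 ≤ P.N₀)
    (hρN : 1 ≤ P.ρN) (a b : ℕ → UnitAddTorus (Fin 2) → ℝ) (has : ∀ j, IsSmooth (a j)) (h0 : a 0 = datum)
    (hb : ∀ j, b j = a j ∘ shearMap 0 1 (amp ⟨P.U j, P.U_periodic j, P.contDiff_U (P.δ_pos hδ₀ hd j)⟩ P.γ))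
    (hab : ∀ j, a (j + 1) = b j ∘ shearMap 1 0 (amp ⟨P.U j, P.U_periodic j, P.contDiff_U (P.δ_pos hδ₀ hd j)⟩ P.γ))
    (j : ℕ) {u v X u' v' Y qn qd cn cd ra rb Λ0 : ℕ} (hu : 0 < u) (hv : 0 < v) (hvu : v < u * G)
    (hqd : 0 < qd) (hq : u * qn < qd * (u * G - v)) (hrb : 0 < rb) (hrab : rb < ra) (hΛ0 : 2 ≤ Λ0) (hΛX : v * Λ0 ≤ u * X)
    (hv' : 0 < v') (hslope : ra * qd * u' ≤ rb * v' * qn)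
    (hbase : qd * (u' * (ra - 1) + rb * v') + ra * qd * u' * Λ0 ≤ rb * v' * qn * Λ0)
    (hcd : cn < cd) (hslope' : ra * qd * cd * u' ≤ rb * cn * v' * qn)
    (hbase' : qd * cd * u' * (ra * Λ0 + (ra - 1)) + rb * cn * v' * qd ≤ rb * cn * v' * qn * Λ0)
    (hY : Y ≤ u' * Λ0 / v' + 1) (Mb : ℕ) {M ε : ℝ} (hM : 1 ≤ M) (hMδ : M * P.δ j < π / 2)
    (hε : Real.exp (-(M ^ 2 / 2)) ≤ ε) :
    ∑' k : Fin 2 → ℤ, (if (X : ℤ) ≤ |k 0| ∧ (u : ℤ) * |k 0| ≤ (v : ℤ) * |k 1| then (1 : ℝ) else 0) *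
        ‖mFourierCoeff (fun x => (a (j + 1) x : ℂ)) k‖ ^ 2 ≤
      (Real.sqrt (6 * (P.N j : ℝ) ^ 2 * (((cd : ℝ) + cn) / ((cd : ℝ) - cn)) *
              (((ra : ℝ) / rb) ^ 2 / ((((ra : ℝ) / rb) ^ 2 - 1) * (((u : ℝ) * G - v) * ((Λ0 : ℝ) - 1) / u) ^ 2) +
                ((ra : ℝ) / rb) / ((((ra : ℝ) / rb) - 1) * (P.N j * (((u : ℝ) * G - v) * ((Λ0 : ℝ) - 1) / u)))) / π ^ 2 +
            12 * (P.N j : ℝ) ^ 2 * ((u : ℝ) * qn * Λ0 / ((((u : ℝ) * G - v) * qd - u * qn) * ((Λ0 : ℝ) - 1))) ^ 2 *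
              (2 * ((qn : ℝ) * Λ0 / qd) / (P.N j * (((u : ℝ) * G - v) * ((Λ0 : ℝ) - 1) / u) ^ 2) + 2 * ((qn : ℝ) * Λ0 / qd) / ((P.N j : ℝ) ^ 2 * (((u : ℝ) * G - v) * ((Λ0 : ℝ) - 1) / u)) +
                1 / (((u : ℝ) * G - v) * ((Λ0 : ℝ) - 1) / u) ^ 2 + 1 / (P.N j * (((u : ℝ) * G - v) * ((Λ0 : ℝ) - 1) / u))) / π ^ 2 / 2) +
          Real.sqrt ((π * ((Λ0 : ℝ) * G) * ((ra : ℝ) / rb) ^ Mb * ε / P.N j) ^ 2 / 2 +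
            Mb * (8 * M * P.δ j / π * (((cd : ℝ) + cn) / ((cd : ℝ) - cn)))) +
          Real.sqrt (∑' k : Fin 2 → ℤ, (if (Y : ℤ) ≤ |k 0| ∧ (u' : ℤ) * |k 1| ≤ (v' : ℤ) * |k 0| then (1 : ℝ) else 0) *
            ‖mFourierCoeff (fun x => (b j x : ℂ)) k‖ ^ 2)) ^ 2 +
        ((1 + P.γ) ^ (2 * (j + 1)) / ((Λ0 * ra ^ Mb / rb ^ Mb : ℕ) : ℝ)) ^ 2 := by
  -- the block family and its cut-offs
  have hN : (0 : ℝ) < P.N j := by exact_mod_cast P.N_pos hN₀ hρN j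
  have hδ : 0 < P.δ j := P.δ_pos hδ₀ hd j
  have hε0 : 0 ≤ ε := (Real.exp_pos _).le.trans hε
  have hra1 : 1 ≤ ra := by omega
  set Λb : ℕ → ℕ := fun m => Λ0 * ra ^ m / rb ^ m with hΛb
  set Q₂ : ℕ → ℕ := fun m => qn * Λb m / qd with hQ₂
  set Q₁ : ℕ → ℕ := fun m => u' * Λb (m + 1) / v' with hQ₁def
  set R : ℕ → ℕ := fun m => Q₂ m - Q₁ m with hRdef
  set ρ : ℝ := (ra : ℝ) / rb with hρdef
  have hrbr : (0 : ℝ) < rb := by exact_mod_cast hrb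
  have hρ1 : 1 < ρ := by
    rw [hρdef, lt_div_iff₀ hrbr, one_mul]; exact_mod_cast hrab
  have hΛmono : Monotone Λb := geom_blocks_monotone hrb hrab.le Λ0
  have hΛge : ∀ m, Λ0 ≤ Λb m := fun m => geom_blocks_ge hrb hrab.le Λ0 m
  have hΛ1 : ∀ m, 1 ≤ Λb m := fun m => le_trans (by omega) (hΛge m)
  have e0 : Λb 0 = Λ0 := geom_blocks_zero Λ0 ra rb
  have hΛb0 : 1 ≤ Λb 0 := hΛ1 0
  have hsucc : ∀ m, rb * Λb (m + 1) ≤ ra * Λb m + (ra - 1) := fun m => geom_blocks_succ_le hrb hra1 Λ0 m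
  have hQ12 : ∀ m, Q₁ m < Q₂ m := fun m => geom_sep hrb hv' hqd (hsucc m) (hΛge m) hslope hbase
  have hfrac : ∀ m, cd * (u' * Λb (m + 1)) ≤ cn * (v' * Q₂ m) := fun m =>
    geom_frac hrb hqd (hsucc m) (hΛge m) hslope' hbase'
  have eQR : ∀ m, Q₁ m + R m = Q₂ m := fun m => Nat.add_sub_cancel' (hQ12 m).le
  have hRpos : ∀ m, 0 < R m := fun m => Nat.sub_pos_of_lt (hQ12 m)
  have hfeed : ∀ m, u' * Λb (m + 1) ≤ v' * (Q₁ m + 1) := fun m => thin_feed u' hv' _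
  have hcd0 : 0 < cd := lt_of_le_of_lt (Nat.zero_le _) hcd
  have hqdr : (0 : ℝ) < qd := by exact_mod_cast hqd
  have hΛ0r : (0 : ℝ) < (Λ0 : ℝ) - 1 := by
    have : (2 : ℝ) ≤ Λ0 := by exact_mod_cast hΛ0
    linarith
  have hcdr : (0 : ℝ) < (cd : ℝ) - cn := by
    have : (cn : ℝ) < cd := by exact_mod_cast hcd
    linarith
  -- the trace ratio of every block
  have hT : ∀ m, (Real.sqrt ((2 * Q₁ m + R m : ℕ) * R m) / R m * 1) ^ 2 / 2 +
      (Real.sqrt ((2 * Q₁ m + R m : ℕ) * R m) / R m * 1) ^ 2 / 2 ≤ ((cd : ℝ) + cn) / ((cd : ℝ) - cn) := fun m => by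
    rw [boxTrace_halves_eq (Q₁ m) (hRpos m)]
    have e1 : 2 * Q₁ m + R m = Q₁ m + Q₂ m := by rw [two_mul, add_assoc, eQR]
    have e2 : ((R m : ℕ) : ℝ) = ((Q₂ m : ℕ) : ℝ) - ((Q₁ m : ℕ) : ℝ) := by
      rw [← eQR m, Nat.cast_add]; ring
    rw [e1, Nat.cast_add, e2]
    exact thin_r_le hv' hcd0 hcd (hQ12 m) (hfrac m)
  have hT0 : ∀ m, 0 ≤ (Real.sqrt ((2 * Q₁ m + R m : ℕ) * R m) / R m * 1) ^ 2 / 2 +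
      (Real.sqrt ((2 * Q₁ m + R m : ℕ) * R m) / R m * 1) ^ 2 / 2 := fun m => by positivity
  have hΛ'0 : ∀ m, (0 : ℝ) ≤ ((Λb (m + 1) * G : ℕ) : ℝ) := fun m => by positivity
  have hΛ' : ∀ m, ((Λb (m + 1) * G : ℕ) : ℝ) ≤ (Λ0 : ℝ) * G * ρ ^ (m + 1) := fun m => geom_top_le hrb G Λ0 m
  have hQ0' : ∀ m, (0 : ℝ) ≤ ((Q₁ m + R m : ℕ) : ℝ) := fun m => by positivity
  set q₀ : ℝ := (qn : ℝ) * Λ0 / qd with hq₀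
  have hq₀0 : 0 ≤ q₀ := by positivity
  have hQle : ∀ m, ((Q₁ m + R m : ℕ) : ℝ) ≤ q₀ * ρ ^ m := fun m => by
    rw [eQR]; exact geom_Q₂_le hrb qn qd Λ0 m
  have hur : (0 : ℝ) < u := by exact_mod_cast hu
  have hc2 : (0 : ℝ) < (u : ℝ) * G - v := by
    have : (v : ℝ) < (u : ℝ) * G := by exact_mod_cast hvu
    linarith
  have hc3 : (0 : ℝ) < ((u : ℝ) * G - v) * qd - u * qn := by
    have h1 : ((u * qn : ℕ) : ℝ) < ((qd * (u * G - v) : ℕ) : ℝ) := by exact_mod_cast hq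
    rw [Nat.cast_mul, Nat.cast_mul, Nat.cast_sub hvu.le, Nat.cast_mul] at h1
    linarith
  set S₀ : ℝ := ((u : ℝ) * G - v) * ((Λ0 : ℝ) - 1) / u with hS₀
  set D₀ : ℝ := (((u : ℝ) * G - v) * qd - u * qn) * ((Λ0 : ℝ) - 1) / (u * qd) with hD₀
  have hS₀pos : 0 < S₀ := by positivity
  have hD₀pos : 0 < D₀ := by positivity
  have hΛQ : ∀ m, u * (Q₁ m + R m) < Λb m * (u * G - v) := fun m => by
    rw [eQR]; exact canon_ratio_shift hq (hΛ1 m)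
  have hDge : ∀ m, D₀ * ρ ^ m ≤ (((u : ℝ) * G - v) * Λb m - u * ((Q₁ m + R m : ℕ) : ℝ)) / u := fun m => by
    rw [eQR]; exact geom_ratio_den_ge hrb hrab.le hu hqd hvu.le hq.le m
  have hS : ∀ m, S₀ * ρ ^ m ≤ (((u : ℝ) * G - v) * Λb m - u * ((Q₁ m + R m : ℕ) : ℝ)) / u + ((Q₁ m + R m : ℕ) : ℝ) := fun m => by
    rw [eQR]; exact geom_ratio_span_ge hrb hrab.le hu hvu.le m
  have eϑ : q₀ / D₀ = (u : ℝ) * qn * Λ0 / ((((u : ℝ) * G - v) * qd - u * qn) * ((Λ0 : ℝ) - 1)) := by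
    rw [hq₀, hD₀]
    field_simp
  have hYm : ∀ m, Y ≤ Q₁ m + 1 := fun m => by
    have h1 : u' * Λ0 / v' ≤ Q₁ m := Nat.div_le_div_right (Nat.mul_le_mul_left _ (hΛge (m + 1)))
    omega
  have hΛX' : v * Λb 0 ≤ u * X := by rw [e0]; exact hΛX
  -- the four scalar bounds in closed form
  have hA := ctTraceGeom_sum_le (D := fun m => (((u : ℝ) * G - v) * Λb m - u * ((Q₁ m + R m : ℕ) : ℝ)) / u)
    (Q := fun m => ((Q₁ m + R m : ℕ) : ℝ)) (T := fun m => (Real.sqrt ((2 * Q₁ m + R m : ℕ) * R m) / R m * 1) ^ 2 / 2 +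
      (Real.sqrt ((2 * Q₁ m + R m : ℕ) * R m) / R m * 1) ^ 2 / 2) (N := (P.N j : ℝ)) (S₀ := S₀)
    (rs := ((cd : ℝ) + cn) / ((cd : ℝ) - cn)) hN hS₀pos hρ1 hS hT0 hT Mb
  have hβ := fun m (_ : m ∈ Finset.range Mb) => ctResidueGeom_le (D := (((u : ℝ) * G - v) * Λb m - u * ((Q₁ m + R m : ℕ) : ℝ)) / u)
    (Q := ((Q₁ m + R m : ℕ) : ℝ)) (N := (P.N j : ℝ)) (D₀ := D₀) (S₀ := S₀) (q₀ := q₀) hN hD₀pos hS₀pos hq₀0 hρ1.le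
    (hDge m) (hS m) (hQ0' m) (hQle m)
  rw [eϑ] at hβ
  have hρ := fun m (hm : m ∈ Finset.range Mb) => ctRoundGeom_le (Λ' := ((Λb (m + 1) * G : ℕ) : ℝ)) (N := (P.N j : ℝ))
    (ℓ₀ := (Λ0 : ℝ) * G) (ε := ε) hN hε0 (by positivity) hρ1.le (hΛ'0 m) (hΛ' m) (Finset.mem_range.mp hm)
  have hZ := ctZone_sum_le (T := fun m => (Real.sqrt ((2 * Q₁ m + R m : ℕ) * R m) / R m * 1) ^ 2 / 2 +
      (Real.sqrt ((2 * Q₁ m + R m : ℕ) * R m) / R m * 1) ^ 2 / 2) (M := M) (δ := P.δ j) (rs := ((cd : ℝ) + cn) / ((cd : ℝ) - cn))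
    (by linarith) hδ.le hT Mb
  beta_reduce at hA hZ
  -- the multi-block step
  have hstep := tsum_ratioClass_vstep_blocks_ctE_le P hγ hδ₀ hd hN₀ hρN a b has h0 hb hab j hu hv hvu Λb hΛmono hΛb0 Mb
    hΛX' Q₁ R hRpos hΛQ hM hMδ hε (u' := u') (v' := v') (Y := Y) hfeed hYm (by positivity) (by positivity) hA hβ hρ hZ
  exact hstep

/-- **(C-H) / (B-H) ON GEOMETRIC BLOCKS OF RATIO `a/b`, CT GRADE, AGGREGATE TRACKED ENERGY.**  Class
`Σ'[Λ₀ ≤ |k₀| ∧ u|k₁| ≤ v|k₀|]‖𝓕b_j‖²` (the class threshold is the fibre floor `Λ₀ ≥ 2`), feed = the class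
`Σ'[Y ≤ |k₀| ∧ u′|k₀| ≤ v′|k₁|]‖𝓕a_j‖²` of `a_j` (`Y ≤ Λ₀`), geometry as in `ratioClass_vstep_geomCTE_le`.  Then
`class ≤ (√(A + β*/2) + √(ρ*/2 + Z) + √feed)² + ((1+γ)^{2j}/Λ_{M_b})²`. [cite: Grafakos2014, Prop. 3.1.2 (5), Prop. 3.2.7 (3), §3.1.3] -/
theorem ratioClass_hstep_geomCTE_le {G : ℕ} (hγ : P.γ = G) (hδ₀ : 0 < P.δ₀) (hd : 0 < P.d) (hN₀ : 1 ≤ P.N₀)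
    (hρN : 1 ≤ P.ρN) (a b : ℕ → UnitAddTorus (Fin 2) → ℝ) (has : ∀ j, IsSmooth (a j)) (h0 : a 0 = datum)
    (hb : ∀ j, b j = a j ∘ shearMap 0 1 (amp ⟨P.U j, P.U_periodic j, P.contDiff_U (P.δ_pos hδ₀ hd j)⟩ P.γ))
    (hab : ∀ j, a (j + 1) = b j ∘ shearMap 1 0 (amp ⟨P.U j, P.U_periodic j, P.contDiff_U (P.δ_pos hδ₀ hd j)⟩ P.γ))
    (j : ℕ) {u v u' v' Y qn qd cn cd ra rb Λ0 : ℕ} (hu : 0 < u) (hv : 0 < v) (hvu : v < u * G)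
    (hqd : 0 < qd) (hq : u * qn < qd * (u * G - v)) (hrb : 0 < rb) (hrab : rb < ra) (hΛ0 : 2 ≤ Λ0) (hY : Y ≤ Λ0)
    (hv' : 0 < v') (hslope : ra * qd * u' ≤ rb * v' * qn)
    (hbase : qd * (u' * (ra - 1) + rb * v') + ra * qd * u' * Λ0 ≤ rb * v' * qn * Λ0)
    (hcd : cn < cd) (hslope' : ra * qd * cd * u' ≤ rb * cn * v' * qn)
    (hbase' : qd * cd * u' * (ra * Λ0 + (ra - 1)) + rb * cn * v' * qd ≤ rb * cn * v' * qn * Λ0)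
    (Mb : ℕ) {M ε : ℝ} (hM : 1 ≤ M) (hMδ : M * P.δ j < π / 2)
    (hε : Real.exp (-(M ^ 2 / 2)) ≤ ε) :
    ∑' k : Fin 2 → ℤ, (if (Λ0 : ℤ) ≤ |k 0| ∧ (u : ℤ) * |k 1| ≤ (v : ℤ) * |k 0| then (1 : ℝ) else 0) *
        ‖mFourierCoeff (fun x => (b j x : ℂ)) k‖ ^ 2 ≤
      (Real.sqrt (6 * (P.N j : ℝ) ^ 2 * (((cd : ℝ) + cn) / ((cd : ℝ) - cn)) *
              (((ra : ℝ) / rb) ^ 2 / ((((ra : ℝ) / rb) ^ 2 - 1) * (((u : ℝ) * G - v) * ((Λ0 : ℝ) - 1) / u) ^ 2) +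
                ((ra : ℝ) / rb) / ((((ra : ℝ) / rb) - 1) * (P.N j * (((u : ℝ) * G - v) * ((Λ0 : ℝ) - 1) / u)))) / π ^ 2 +
            12 * (P.N j : ℝ) ^ 2 * ((u : ℝ) * qn * Λ0 / ((((u : ℝ) * G - v) * qd - u * qn) * ((Λ0 : ℝ) - 1))) ^ 2 *
              (2 * ((qn : ℝ) * Λ0 / qd) / (P.N j * (((u : ℝ) * G - v) * ((Λ0 : ℝ) - 1) / u) ^ 2) + 2 * ((qn : ℝ) * Λ0 / qd) / ((P.N j : ℝ) ^ 2 * (((u : ℝ) * G - v) * ((Λ0 : ℝ) - 1) / u)) +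
                1 / (((u : ℝ) * G - v) * ((Λ0 : ℝ) - 1) / u) ^ 2 + 1 / (P.N j * (((u : ℝ) * G - v) * ((Λ0 : ℝ) - 1) / u))) / π ^ 2 / 2) +
          Real.sqrt ((π * ((Λ0 : ℝ) * G) * ((ra : ℝ) / rb) ^ Mb * ε / P.N j) ^ 2 / 2 +
            Mb * (8 * M * P.δ j / π * (((cd : ℝ) + cn) / ((cd : ℝ) - cn)))) +
          Real.sqrt (∑' k : Fin 2 → ℤ, (if (Y : ℤ) ≤ |k 0| ∧ (u' : ℤ) * |k 0| ≤ (v' : ℤ) * |k 1| then (1 : ℝ) else 0) *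
            ‖mFourierCoeff (fun x => (a j x : ℂ)) k‖ ^ 2)) ^ 2 +
        ((1 + P.γ) ^ (2 * j) / ((Λ0 * ra ^ Mb / rb ^ Mb : ℕ) : ℝ)) ^ 2 := by
  -- the block family and its cut-offs
  have hN : (0 : ℝ) < P.N j := by exact_mod_cast P.N_pos hN₀ hρN j
  have hδ : 0 < P.δ j := P.δ_pos hδ₀ hd j
  have hε0 : 0 ≤ ε := (Real.exp_pos _).le.trans hε
  have hra1 : 1 ≤ ra := by omega
  set Λb : ℕ → ℕ := fun m => Λ0 * ra ^ m / rb ^ m with hΛb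
  set Q₂ : ℕ → ℕ := fun m => qn * Λb m / qd with hQ₂
  set Q₁ : ℕ → ℕ := fun m => u' * Λb (m + 1) / v' with hQ₁def
  set R : ℕ → ℕ := fun m => Q₂ m - Q₁ m with hRdef
  set ρ : ℝ := (ra : ℝ) / rb with hρdef
  have hrbr : (0 : ℝ) < rb := by exact_mod_cast hrb
  have hρ1 : 1 < ρ := by
    rw [hρdef, lt_div_iff₀ hrbr, one_mul]; exact_mod_cast hrab
  have hΛmono : Monotone Λb := geom_blocks_monotone hrb hrab.le Λ0
  have hΛge : ∀ m, Λ0 ≤ Λb m := fun m => geom_blocks_ge hrb hrab.le Λ0 m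
  have hΛ1 : ∀ m, 1 ≤ Λb m := fun m => le_trans (by omega) (hΛge m)
  have e0 : Λb 0 = Λ0 := geom_blocks_zero Λ0 ra rb
  have hΛb0 : 1 ≤ Λb 0 := hΛ1 0
  have hsucc : ∀ m, rb * Λb (m + 1) ≤ ra * Λb m + (ra - 1) := fun m => geom_blocks_succ_le hrb hra1 Λ0 m
  have hQ12 : ∀ m, Q₁ m < Q₂ m := fun m => geom_sep hrb hv' hqd (hsucc m) (hΛge m) hslope hbase
  have hfrac : ∀ m, cd * (u' * Λb (m + 1)) ≤ cn * (v' * Q₂ m) := fun m =>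
    geom_frac hrb hqd (hsucc m) (hΛge m) hslope' hbase'
  have eQR : ∀ m, Q₁ m + R m = Q₂ m := fun m => Nat.add_sub_cancel' (hQ12 m).le
  have hRpos : ∀ m, 0 < R m := fun m => Nat.sub_pos_of_lt (hQ12 m)
  have hfeed : ∀ m, u' * Λb (m + 1) ≤ v' * (Q₁ m + 1) := fun m => thin_feed u' hv' _
  have hcd0 : 0 < cd := lt_of_le_of_lt (Nat.zero_le _) hcd
  have hqdr : (0 : ℝ) < qd := by exact_mod_cast hqd
  have hΛ0r : (0 : ℝ) < (Λ0 : ℝ) - 1 := by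
    have : (2 : ℝ) ≤ Λ0 := by exact_mod_cast hΛ0
    linarith
  have hcdr : (0 : ℝ) < (cd : ℝ) - cn := by
    have : (cn : ℝ) < cd := by exact_mod_cast hcd
    linarith
  -- the trace ratio of every block
  have hT : ∀ m, (Real.sqrt ((2 * Q₁ m + R m : ℕ) * R m) / R m * 1) ^ 2 / 2 +
      (Real.sqrt ((2 * Q₁ m + R m : ℕ) * R m) / R m * 1) ^ 2 / 2 ≤ ((cd : ℝ) + cn) / ((cd : ℝ) - cn) := fun m => by
    rw [boxTrace_halves_eq (Q₁ m) (hRpos m)]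
    have e1 : 2 * Q₁ m + R m = Q₁ m + Q₂ m := by rw [two_mul, add_assoc, eQR]
    have e2 : ((R m : ℕ) : ℝ) = ((Q₂ m : ℕ) : ℝ) - ((Q₁ m : ℕ) : ℝ) := by
      rw [← eQR m, Nat.cast_add]; ring
    rw [e1, Nat.cast_add, e2]
    exact thin_r_le hv' hcd0 hcd (hQ12 m) (hfrac m)
  have hT0 : ∀ m, 0 ≤ (Real.sqrt ((2 * Q₁ m + R m : ℕ) * R m) / R m * 1) ^ 2 / 2 +
      (Real.sqrt ((2 * Q₁ m + R m : ℕ) * R m) / R m * 1) ^ 2 / 2 := fun m => by positivity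
  have hΛ'0 : ∀ m, (0 : ℝ) ≤ ((Λb (m + 1) * G : ℕ) : ℝ) := fun m => by positivity
  have hΛ' : ∀ m, ((Λb (m + 1) * G : ℕ) : ℝ) ≤ (Λ0 : ℝ) * G * ρ ^ (m + 1) := fun m => geom_top_le hrb G Λ0 m
  have hQ0' : ∀ m, (0 : ℝ) ≤ ((Q₁ m + R m : ℕ) : ℝ) := fun m => by positivity
  set q₀ : ℝ := (qn : ℝ) * Λ0 / qd with hq₀
  have hq₀0 : 0 ≤ q₀ := by positivity
  have hQle : ∀ m, ((Q₁ m + R m : ℕ) : ℝ) ≤ q₀ * ρ ^ m := fun m => by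
    rw [eQR]; exact geom_Q₂_le hrb qn qd Λ0 m
  have hur : (0 : ℝ) < u := by exact_mod_cast hu
  have hc2 : (0 : ℝ) < (u : ℝ) * G - v := by
    have : (v : ℝ) < (u : ℝ) * G := by exact_mod_cast hvu
    linarith
  have hc3 : (0 : ℝ) < ((u : ℝ) * G - v) * qd - u * qn := by
    have h1 : ((u * qn : ℕ) : ℝ) < ((qd * (u * G - v) : ℕ) : ℝ) := by exact_mod_cast hq
    rw [Nat.cast_mul, Nat.cast_mul, Nat.cast_sub hvu.le, Nat.cast_mul] at h1
    linarith
  set S₀ : ℝ := ((u : ℝ) * G - v) * ((Λ0 : ℝ) - 1) / u with hS₀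
  set D₀ : ℝ := (((u : ℝ) * G - v) * qd - u * qn) * ((Λ0 : ℝ) - 1) / (u * qd) with hD₀
  have hS₀pos : 0 < S₀ := by positivity
  have hD₀pos : 0 < D₀ := by positivity
  have hΛQ : ∀ m, u * (Q₁ m + R m) < Λb m * (u * G - v) := fun m => by
    rw [eQR]; exact canon_ratio_shift hq (hΛ1 m)
  have hDge : ∀ m, D₀ * ρ ^ m ≤ (((u : ℝ) * G - v) * Λb m - u * ((Q₁ m + R m : ℕ) : ℝ)) / u := fun m => by
    rw [eQR]; exact geom_ratio_den_ge hrb hrab.le hu hqd hvu.le hq.le m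
  have hS : ∀ m, S₀ * ρ ^ m ≤ (((u : ℝ) * G - v) * Λb m - u * ((Q₁ m + R m : ℕ) : ℝ)) / u + ((Q₁ m + R m : ℕ) : ℝ) := fun m => by
    rw [eQR]; exact geom_ratio_span_ge hrb hrab.le hu hvu.le m
  have eϑ : q₀ / D₀ = (u : ℝ) * qn * Λ0 / ((((u : ℝ) * G - v) * qd - u * qn) * ((Λ0 : ℝ) - 1)) := by
    rw [hq₀, hD₀]
    field_simp
  -- the four scalar bounds in closed form
  have hA := ctTraceGeom_sum_le (D := fun m => (((u : ℝ) * G - v) * Λb m - u * ((Q₁ m + R m : ℕ) : ℝ)) / u)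
    (Q := fun m => ((Q₁ m + R m : ℕ) : ℝ)) (T := fun m => (Real.sqrt ((2 * Q₁ m + R m : ℕ) * R m) / R m * 1) ^ 2 / 2 +
      (Real.sqrt ((2 * Q₁ m + R m : ℕ) * R m) / R m * 1) ^ 2 / 2) (N := (P.N j : ℝ)) (S₀ := S₀)
    (rs := ((cd : ℝ) + cn) / ((cd : ℝ) - cn)) hN hS₀pos hρ1 hS hT0 hT Mb
  have hβ := fun m (_ : m ∈ Finset.range Mb) => ctResidueGeom_le (D := (((u : ℝ) * G - v) * Λb m - u * ((Q₁ m + R m : ℕ) : ℝ)) / u)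
    (Q := ((Q₁ m + R m : ℕ) : ℝ)) (N := (P.N j : ℝ)) (D₀ := D₀) (S₀ := S₀) (q₀ := q₀) hN hD₀pos hS₀pos hq₀0 hρ1.le
    (hDge m) (hS m) (hQ0' m) (hQle m)
  rw [eϑ] at hβ
  have hρ := fun m (hm : m ∈ Finset.range Mb) => ctRoundGeom_le (Λ' := ((Λb (m + 1) * G : ℕ) : ℝ)) (N := (P.N j : ℝ))
    (ℓ₀ := (Λ0 : ℝ) * G) (ε := ε) hN hε0 (by positivity) hρ1.le (hΛ'0 m) (hΛ' m) (Finset.mem_range.mp hm)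
  have hZ := ctZone_sum_le (T := fun m => (Real.sqrt ((2 * Q₁ m + R m : ℕ) * R m) / R m * 1) ^ 2 / 2 +
      (Real.sqrt ((2 * Q₁ m + R m : ℕ) * R m) / R m * 1) ^ 2 / 2) (M := M) (δ := P.δ j) (rs := ((cd : ℝ) + cn) / ((cd : ℝ) - cn))
    (by linarith) hδ.le hT Mb
  beta_reduce at hA hZ
  -- the multi-block step
  have hstep := tsum_ratioClass_hstep_blocks_ctE_le P hγ hδ₀ hd hN₀ hρN a b has h0 hb hab j hu hv hvu Λb hΛmono hΛb0 Mb
    Q₁ R hRpos hΛQ hM hMδ hε (u' := u') (v' := v') (Y := Y) hfeed (by rw [e0]; exact hY) (by positivity) (by positivity)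
    hA hβ hρ hZ
  rw [e0] at hstep
  exact hstep

end Cascade

end Summit.AnomalousDissipation.AnomalousDissipation.Theorems.SawtoothPulseCascade.K1Window
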